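import Mathlib.Analysis.InnerProductSpace.Laplacian
import Mathlib.Analysis.InnerProductSpace.PiL2
import Mathlib.Analysis.SpecialFunctions.Pow.Real
import HarnessLib

/-!
# Weighted Schauder solvability of the Poisson equation on `ℝ³` (Lee–Parker 1987, Thm. 9.2)

Analysis/PDE statement file (two weighted-Hölder NOTIONS, one parametrised PREDICATE, ONE named fact
in printed generality; no `sorry`). Typing job #2 of the Navier–Stokes cell (DIRECTOR-NS KEY-NS #196,
2026-08-29): the line «onsager-companion» (skeleton `OnsagerCompanion_v12/v13.lean` §3d) carries
exactly one non-proved input, the weighted Schauder solvability `WeightedSchauderPoisson (4/3) σ`,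
`0 < σ < 1`; this file states it as Literature so that the chain can land «modulo a registered
Literature fact». The predicate is the §3d text VERBATIM (with `E3` spelled `EuclideanSpace ℝ (Fin 3)`);
nothing refers to Navier–Stokes.

**Weighted Hölder classes on `ℝ³`** (Lee–Parker 1987, §9 p. 75: weight function `ρ`, the index
`β` "reflects order of growth: functions in `C^{k,α}_β` grow at most like `ρ^β`"; here `ρ = 1 + |x|`
and the Hölder modulus is asked on the standard balls `|x − y| ≤ ρ(x)/2`, on which
`ρ(x)/2 ≤ ρ(y) ≤ 3ρ(x)/2`, so the norms are equivalent to the printed ones up to a factor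
`2^{τ+σ+1}`):

* `InWeightedHolder τ σ f A` — `f ∈ C^{0,σ}_{−τ}` with norm `≤ A`;
* `InWeightedHolderTwo τ σ u B` — `u ∈ C^{2,σ}_{2−τ}` with norm `≤ B` (sup bounds on `u, Du, D²u`
  and the modulus of `D²u`).

**The predicate** `WeightedSchauderPoisson τ σ`: one constant `C = C(τ,σ)` such that every smooth
`f ∈ C^{0,σ}_{−τ}(ℝ³)` has a smooth solution `u` of `Δu = f` with `‖u‖_{C^{2,σ}_{2−τ}} ≤ C‖f‖`.

**The fact** `WeightedSchauderPoissonWindow`: the predicate holds for `1 < τ < 2`, `0 < σ < 1` — the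
growth weight `β = 2 − τ ∈ (0,1)` is non-exceptional (`β ∉ ℤ`, `β > 2 − n`), so by Lee–Parker
Thm. 9.2 (b) the Laplacian is surjective between the weighted spaces (kernel = harmonic polynomials of
degree `≤ β`, i.e. constants) and by Thm. 9.2 (c) (the WEIGHTED SCHAUDER estimate, Chaljub-Simon &
Choquet-Bruhat 1979 for `n = 3`) a `C^0_β` solution with `Δu ∈ C^{0,σ}_{β−2}` lies in `C^{2,σ}_β` with
`‖u‖_{C^{2,σ}_β} ≤ C(‖Δu‖_{C^{0,σ}_{β−2}} + ‖u‖_{C^0_β})`; the `C^0_β` solution with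
`‖u‖_{C^0_β} ≤ C‖f‖_{C^0_{β−2}}` is the first-order-subtracted Newtonian potential
`u(x) = −(4π)⁻¹ ∫ f(y)(|x−y|⁻¹ − |y|⁻¹) dy` (three-region estimate; Meyers 1963; Galdi, Lemma II.9.2),
and `u` is smooth for smooth `f` by interior elliptic regularity (Gilbarg–Trudinger Thm. 6.17).
CAVEAT (typed honestly in the consumer's skeleton and kept here): at `σ = 1` or at integer `β` the
predicate is NOT asserted (`C^{0,1}` data do not give `C^{2,1}` solutions; integer weights are
exceptional) — the fact quantifies only over the printed window.

* `weightedSchauderPoisson_of_window` — the instantiation at the consumer's weight `τ = 4/3`.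

Mathlib / tree status (`lean search`, 2026-08-29): no Riesz-transform, Calderón–Zygmund or weighted
Schauder theory for the Poisson equation on `ℝⁿ` (the tree's `Literature/Analysis/SingularIntegrals`
has Hörmander's condition and the `L^p` Hessian bound for the heat kernel only); hence a named fact.

## References

* J. M. Lee, T. H. Parker, *The Yamabe problem*, Bull. Amer. Math. Soc. 17 (1987) 37–91, §9:
  weighted spaces p. 75, **Theorem 9.2 (b), (c)** p. 76
  [corpus: paper:doi-10-1090-s0273-0979-1987-15514-5 p0039–p0040]. [LeeParker1987]
* A. Chaljub-Simon, Y. Choquet-Bruhat, *Problèmes elliptiques du second ordre sur une variété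
  euclidienne à l'infini*, Ann. Fac. Sci. Toulouse 1 (1979) 9–25 (the weighted Schauder estimate,
  `n = 3`; acquisition acq-14442).
* N. Meyers, *An expansion about infinity for solutions of linear elliptic equations*, J. Math.
  Mech. 12 (1963) 247–264 (growth of the subtracted Newtonian potential).
* D. Gilbarg, N. S. Trudinger, *Elliptic PDE of Second Order* (2001), Thm. 4.3, Thm. 6.17.
  [GilbargTrudinger2001]
-/

noncomputable section

open scoped Laplacian

namespace Literature.Analysis.PDE

/-! ### Weighted Hölder classes on `ℝ³` (weight `ρ = 1 + |x|`, balls `|x − y| ≤ ρ(x)/2`) -/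

/-- `f ∈ C^{0,σ}_{−τ}(ℝ³)` with norm `≤ A` (Lee–Parker's weighted Hölder space `C^{0,σ}_β`,
`β = −τ` the order of growth, weight `ρ = 1 + |x|`): `|f(x)| ≤ A ρ(x)^{−τ}` and
`|f(x) − f(y)| ≤ A ρ(x)^{−τ−σ} |x − y|^σ` whenever `|x − y| ≤ ρ(x)/2`.
[cite: LeeParker1987, §9 p. 75 (weighted Hölder spaces C^{k,α}_β)] -/
def InWeightedHolder (τ σ : ℝ) (f : EuclideanSpace ℝ (Fin 3) → ℝ) (A : ℝ) : Prop :=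
  (∀ x, |f x| ≤ A * (1 + ‖x‖) ^ (-τ)) ∧
  ∀ x y, ‖x - y‖ ≤ (1 + ‖x‖) / 2 → |f x - f y| ≤ A * (1 + ‖x‖) ^ (-(τ + σ)) * ‖x - y‖ ^ σ

/-- `u ∈ C^{2,σ}_{2−τ}(ℝ³)` with norm `≤ B` (Lee–Parker's `C^{2,σ}_β`, `β = 2 − τ`): `|u| ≤ B ρ^{2−τ}`,
`|Du| ≤ B ρ^{1−τ}`, `|D²u| ≤ B ρ^{−τ}`, `|D²u(x) − D²u(y)| ≤ B ρ(x)^{−τ−σ}|x − y|^σ` whenever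
`|x − y| ≤ ρ(x)/2`. [cite: LeeParker1987, §9 p. 75 (weighted Hölder spaces C^{k,α}_β)] -/
def InWeightedHolderTwo (τ σ : ℝ) (u : EuclideanSpace ℝ (Fin 3) → ℝ) (B : ℝ) : Prop :=
  (∀ x, |u x| ≤ B * (1 + ‖x‖) ^ (2 - τ)) ∧
  (∀ x, ‖fderiv ℝ u x‖ ≤ B * (1 + ‖x‖) ^ (1 - τ)) ∧
  (∀ x, ‖fderiv ℝ (fderiv ℝ u) x‖ ≤ B * (1 + ‖x‖) ^ (-τ)) ∧
  ∀ x y, ‖x - y‖ ≤ (1 + ‖x‖) / 2 →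
    ‖fderiv ℝ (fderiv ℝ u) x - fderiv ℝ (fderiv ℝ u) y‖ ≤ B * (1 + ‖x‖) ^ (-(τ + σ)) * ‖x - y‖ ^ σ

/-- Unfolding `InWeightedHolder` (the two clauses of Lee–Parker's weighted `C^{0,σ}` norm). [cite: LeeParker1987, §9 p. 75 (weighted Hölder spaces C^{k,α}_β)] -/
theorem inWeightedHolder_iff {τ σ : ℝ} {f : EuclideanSpace ℝ (Fin 3) → ℝ} {A : ℝ} :
    InWeightedHolder τ σ f A ↔
      (∀ x, |f x| ≤ A * (1 + ‖x‖) ^ (-τ)) ∧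
      ∀ x y, ‖x - y‖ ≤ (1 + ‖x‖) / 2 →
        |f x - f y| ≤ A * (1 + ‖x‖) ^ (-(τ + σ)) * ‖x - y‖ ^ σ :=
  Iff.rfl

/-! ### The weighted Schauder solvability predicate and the printed fact -/

/-- **`WeightedSchauderPoisson τ σ` — weighted Schauder SOLVABILITY of the Poisson equation on
`ℝ³`** (a predicate in the weights; asserted as a fact only on the printed window, see
`WeightedSchauderPoissonWindow`): there is ONE constant `C = C(τ,σ)` such that for every smooth
`f ∈ C^{0,σ}_{−τ}(ℝ³)` with norm `≤ A` there is a smooth `u` with `Δu = f` and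
`‖u‖_{C^{2,σ}_{2−τ}} ≤ C·A` (`|u| ≤ CAρ^{2−τ}`, `|Du| ≤ CAρ^{1−τ}`, `|D²u| ≤ CAρ^{−τ}`,
`[D²u]_{σ;B(x,ρ/2)} ≤ CAρ^{−τ−σ}`). This is the §3d text of the consumer's skeleton, verbatim.
[cite: LeeParker1987, Thm 9.2 (b)(c) p. 76 (the solvability pattern Δ : C^{2,α}_β → C^{0,α}_{β−2})] -/
def WeightedSchauderPoisson (τ σ : ℝ) : Prop :=
  ∃ C : ℝ, ∀ (f : EuclideanSpace ℝ (Fin 3) → ℝ) (A : ℝ), ContDiff ℝ (⊤ : ℕ∞) f →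
    InWeightedHolder τ σ f A →
    ∃ u : EuclideanSpace ℝ (Fin 3) → ℝ, ContDiff ℝ (⊤ : ℕ∞) u ∧ (∀ x, (Δ u) x = f x) ∧
      InWeightedHolderTwo τ σ u (C * A)

/-- **NAMED FACT (Lee–Parker 1987, Thm. 9.2 (b)(c), on `N = ℝ³`)**: for every growth weight
`β = 2 − τ ∈ (0,1)` (i.e. `1 < τ < 2`) and every Hölder exponent `0 < σ < 1`, the Laplacian
`Δ : C^{2,σ}_β(ℝ³) → C^{0,σ}_{β−2}(ℝ³)` is surjective on smooth data with a bounded right inverse: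
"(b) … if `β ∉ ℤ`, `Δ` is surjective for all `β > 2 − n` …, and the dimension of `ker Δ` is … the
space of harmonic polynomials of degree `≤ β`. (c) If `u ∈ C^0_β(N)` and `Δu ∈ C^{0,α}_{β−2}(N)`, then
`u ∈ C^{2,α}_β(N)` and `‖u‖_{C^{2,α}_β} ≤ C(‖Δu‖_{C^{0,α}_{β−2}} + ‖u‖_{C^0_β})`" — the `C^0_β`
solution being the first-order-subtracted Newtonian potential (`|u| ≤ C‖f‖ρ^β`, Meyers 1963), smooth by
interior regularity. On the window `β ∈ (0,1)` no weight is exceptional. NOT asserted at `σ = 1` or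
integer `β`. [cite: LeeParker1987, Thm 9.2 (b)(c) p. 76 (Bull. AMS 17; corpus p0040)] -/
def WeightedSchauderPoissonWindow : Prop :=
  ∀ τ σ : ℝ, 1 < τ → τ < 2 → 0 < σ → σ < 1 → WeightedSchauderPoisson τ σ

/-- **The consumer's weight**: `WeightedSchauderPoissonWindow` instantiated at `τ = 4/3`
(`β = 2/3`), `0 < σ < 1` — the hypothesis `(hW : WeightedSchauderPoisson (4/3) σ)` of the
«onsager-companion» chain. [cite: LeeParker1987, Thm 9.2 (b)(c) p. 76] -/
theorem weightedSchauderPoisson_of_window (h : WeightedSchauderPoissonWindow) {σ : ℝ} (hσ0 : 0 < σ)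
    (hσ1 : σ < 1) : WeightedSchauderPoisson (4 / 3) σ :=
  h (4 / 3) σ (by norm_num) (by norm_num) hσ0 hσ1

end Literature.Analysis.PDE

end
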